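import Literature.NumberTheory.Automorphic.OrbitalMeasureOfLocal
import Literature.NumberTheory.Automorphic.UnitaryGroupOrbitalIntegralArchFinSplit
import Literature.MeasureTheory.Group.OrbitalMeasureOfProd
import HarnessLib

/-!
# Adelic orbital measures of `U(H)` BUILT FROM LOCAL ONES: `dg = dg_∞ ⊗ ⊗'_v dg_v` on `U(H)(𝔸) ⧸ U(H)(𝔸)_g`, with the EXACT Euler product
# `Φ(g, f_∞ ⊗ ⊗_v f_v) = Φ_∞(g_∞, f_∞) · ∏_v Φ_v(g_v, f_v)` (Rogawski (1990) §5.4 p. 72; Gelbart (1975) p. 155 (10.19))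

Topic `NumberTheory/Automorphic`; namespace `Literature.NumberTheory.Automorphic.UnitaryGroup`. Two definitions (with bodies) and theorems;
no instance, no named fact, no `sorry`.  The `U(H)` dress of ★ `orbitalMeasureOfLocal` (finite-adelic restricted product, model
`finAdelicEquiv : U(H)(𝔸_{L⁺,f}) ≃ₜ* ∏'_v (U(H)_v : U(H)(𝒪_v))`, local models `localPiEquiv v : U(H)_v ≃ₜ* (cmDatum L N H).Local v`) composed
with ★ `orbitalMeasureOfProd` along ★ `adelicProdEquiv : U(H)(𝔸) ≃ₜ* U(H)(L ⊗ ℝ) × U(H)(𝔸_f)`: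

* §1 **`finAdelicOrbitalMeasureOfLocal L N H g m S₀`** — the measure on `U(H)(𝔸_f) ⧸ C(g_f)` built from measures `m v` on
  `U(H)(L⁺_v) ⧸ C(g_v)` (`g_v = toLocal v g`; exceptional finite set `S₀` off which `m v (π U(H)(𝒪_v)) = 1`);
  `finAdelicOrbitalMeasureOfLocal_spec`: admissible (invariant, finite on compacta, `≠ 0`) for admissible normalised inputs, independent of
  `S₀`, and **`orbitalIntegral g_f F μ_f = ∏_{v∈S₂} localOrbitalIntegral v g_v f_v (m v)`** for finite-adelic pure tensors `F` whose local
  orbital integrals are `1` off `S₂` (W8-shape: finite product over any such `S₂`; the partial products converge to the orbital integral) —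
  the `∃ c ≠ 0` of ★ `UnitaryGroup.exists_orbitalIntegral_finPart_eq_smul_prod` becomes `c = 1` for THIS measure;
  `orbitalIntegral_finPart_finFactor_ofLocal_eq_prod` — the same for B13's finite-adelic factor `Λ_T` of a ★ `PureTensor`.
* §2 **`adelicOrbitalMeasureOfLocal L N H g ma m S₀`** — the measure on `U(H)(𝔸) ⧸ C(g)` built from `ma` on `U(H)(L ⊗ ℝ) ⧸ C(g_∞)` and the
  `m v` (★ `orbitalMeasureOfProd`, `κ = 1`); `adelicOrbitalMeasureOfLocal_spec` (admissible; `orbitalIntegral g (F₁ ⊗ F₂) = O_{g_∞}(F₁) ·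
  O_{g_f}(F₂)` EXACTLY); **`orbitalIntegral_eval_adelicOrbitalMeasureOfLocal_eq_mul_prod`**: for a pure tensor `T` with integral levels off `T.S`,
  `orbitalIntegral g T.eval μ = orbitalIntegral g_∞ T.arch ma · ∏_{v∈S₂} localOrbitalIntegral v g_v (T.loc v) (m v)` whenever the local orbital
  integrals are `1` off `S₂` (and `Λ_T` has an integrable orbital integrand) — NO constant (referee watch-list W7∕Δ13: the currency in which
  a trace formula is keyed to local transfer relations place by place).
The class-indexed family `AdelicOrbitalMeasureFamily.ofLocal` (local CLASS-indexed families read at the components of rational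
representatives) is the sequel `UnitaryGroupOrbitalMeasureFamilyOfLocal`.

## References
* J. D. Rogawski, *Automorphic Representations of Unitary Groups in Three Variables* (1990), §4.3 p. 44, §5.4 pp. 71–72 [Rogawski1990].
* S. Gelbart, *Automorphic forms on adele groups*, Ann. of Math. Stud. 83 (1975), p. 155 (10.19) [Gelbart1975].
* A. Borel, H. Jacquet, *Automorphic forms and automorphic representations*, PSPM 33.1 (1979), §4.1 [BorelJacquet1979].
-/

noncomputable section

open MeasureTheory Measure Set Filter Topology NumberField IsDedekindDomain
open Literature.MeasureTheory.Group Literature.MeasureTheory.RestrictedProduct Literature.Topology.RestrictedProduct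
open scoped ENNReal NNReal RestrictedProduct

namespace Literature.NumberTheory.Automorphic

namespace UnitaryGroup

variable (L : Type) [Field L] [NumberField L] [IsCMField L] (N : ℕ) (H : Matrix (Fin N) (Fin N) L)

/-! ## §1 The finite-adelic orbital measure from local ones -/

section Fin

variable (g : (cmDatum L N H).Adelic)
  [∀ v, MeasurableSpace ((cmDatum L N H).Local v ⧸ Subgroup.centralizer ({((cmDatum L N H).toLocal v g)} : Set ((cmDatum L N H).Local v)))]
  (m : ∀ v, Measure ((cmDatum L N H).Local v ⧸ Subgroup.centralizer ({((cmDatum L N H).toLocal v g)} : Set ((cmDatum L N H).Local v))))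
  [MeasurableSpace (finAdelic (↥(maximalRealSubfield L)) L (IsCMField.complexConj L) N H ⧸ Subgroup.centralizer ({(finPart (↥(maximalRealSubfield L)) L (IsCMField.complexConj L) N H g)} : Set (finAdelic (↥(maximalRealSubfield L)) L (IsCMField.complexConj L) N H)))]

/-- **The orbital measure on `U(H)(𝔸_{L⁺,f}) ⧸ C(g_f)` BUILT FROM LOCAL ONES** `m v` on `U(H)(L⁺_v) ⧸ C(g_v)`, `g_v = toLocal v g`: ★
`orbitalMeasureOfLocal` for the model `finAdelicEquiv`, local models `localPiEquiv v`, exceptional finite set `S₀` (off which the `m v` are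
meant to give mass `1` to `π U(H)(𝒪_v)`).  No rescaling. [cite: Rogawski1990, §5.4 p. 72] -/
def finAdelicOrbitalMeasureOfLocal (S₀ : Finset (HeightOneSpectrum (𝓞 ↥(maximalRealSubfield L)))) :
    Measure (finAdelic (↥(maximalRealSubfield L)) L (IsCMField.complexConj L) N H ⧸ Subgroup.centralizer ({(finPart (↥(maximalRealSubfield L)) L (IsCMField.complexConj L) N H g)} : Set (finAdelic (↥(maximalRealSubfield L)) L (IsCMField.complexConj L) N H))) :=
  orbitalMeasureOfLocal (fun v => localInt L (IsCMField.complexConj L) N H v) (Lc := fun v => (cmDatum L N H).Local v)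
    (fun v => localPiEquiv L (IsCMField.complexConj L) N H v)
    (finAdelicEquiv (↥(maximalRealSubfield L)) L (IsCMField.complexConj L) N H)
    (finPart (↥(maximalRealSubfield L)) L (IsCMField.complexConj L) N H g) (fun v => (cmDatum L N H).toLocal v g)
    (fun v => localPiEquiv_evalPlace_finPart (↥(maximalRealSubfield L)) L (IsCMField.complexConj L) N H v g) m S₀

variable [BorelSpace (finAdelic (↥(maximalRealSubfield L)) L (IsCMField.complexConj L) N H ⧸ Subgroup.centralizer ({(finPart (↥(maximalRealSubfield L)) L (IsCMField.complexConj L) N H g)} : Set (finAdelic (↥(maximalRealSubfield L)) L (IsCMField.complexConj L) N H)))]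
  [∀ v, BorelSpace ((cmDatum L N H).Local v ⧸ Subgroup.centralizer ({((cmDatum L N H).toLocal v g)} : Set ((cmDatum L N H).Local v)))]
  [∀ v, SMulInvariantMeasure ((cmDatum L N H).Local v)
    ((cmDatum L N H).Local v ⧸ Subgroup.centralizer ({((cmDatum L N H).toLocal v g)} : Set ((cmDatum L N H).Local v))) (m v)]
  [∀ v, IsFiniteMeasureOnCompacts (m v)]

/-- **Admissibility and exact Euler products of `finAdelicOrbitalMeasureOfLocal`** (★ `orbitalMeasureOfLocal_spec` dressed): for invariant
`m v` finite on compacta with `m v (π U(H)(𝒪_v)) = 1` off `S₀` and `m v ≠ 0` on `S₀`, `μ_f = finAdelicOrbitalMeasureOfLocal L N H g m S₀` is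
invariant, finite on compacta, non-zero, independent of `S₀`, and for every finite-adelic pure tensor `F`
(`F b = ∏_{v∈S} f_v((b)_v)` on the cylinders `b_v ∈ U(H)(𝒪_v)`, `v ∉ S`, all `S ⊇ S₁ ⊇ S₀ ∪ S_{g_f}`) with `μ_f`-integrable orbital integrand:
`∏_{v∈U} localOrbitalIntegral v g_v f_v (m v) ⟶ orbitalIntegral g_f F μ_f` and
`∀ S₂, (∀ v ∉ S₂, localOrbitalIntegral v g_v f_v (m v) = 1) → orbitalIntegral g_f F μ_f = ∏_{v∈S₂} localOrbitalIntegral v g_v f_v (m v)` — NO constant.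
[cite: Gelbart1975, p. 155 (10.19)] [cite: Rogawski1990, §5.4 p. 72] -/
theorem finAdelicOrbitalMeasureOfLocal_spec {S₀ : Finset (HeightOneSpectrum (𝓞 ↥(maximalRealSubfield L)))}
    (hm1 : ∀ v, v ∉ S₀ → m v ((QuotientGroup.mk : (cmDatum L N H).Local v → _) ''
      (cmLocalIntegralLevel L N H v : Set ((cmDatum L N H).Local v))) = 1)
    (hm : ∀ v, v ∈ S₀ → m v ≠ 0) :
    SMulInvariantMeasure (finAdelic (↥(maximalRealSubfield L)) L (IsCMField.complexConj L) N H) _ (finAdelicOrbitalMeasureOfLocal L N H g m S₀) ∧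
      IsFiniteMeasureOnCompacts (finAdelicOrbitalMeasureOfLocal L N H g m S₀) ∧
      finAdelicOrbitalMeasureOfLocal L N H g m S₀ ≠ 0 ∧
      (∀ S₀' : Finset (HeightOneSpectrum (𝓞 ↥(maximalRealSubfield L))), S₀ ⊆ S₀' →
        finAdelicOrbitalMeasureOfLocal L N H g m S₀' = finAdelicOrbitalMeasureOfLocal L N H g m S₀) ∧
      ∀ (f : ∀ v, (cmDatum L N H).Local v → ℂ) (F : finAdelic (↥(maximalRealSubfield L)) L (IsCMField.complexConj L) N H → ℂ)
        (S₁ : Finset (HeightOneSpectrum (𝓞 ↥(maximalRealSubfield L)))),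
        (∀ S : Finset (HeightOneSpectrum (𝓞 ↥(maximalRealSubfield L))), S₁ ⊆ S → ∀ b : finAdelic (↥(maximalRealSubfield L)) L (IsCMField.complexConj L) N H,
          (∀ v, v ∉ S → evalPlace (↥(maximalRealSubfield L)) L (IsCMField.complexConj L) N H v b ∈ localInt L (IsCMField.complexConj L) N H v) →
          F b = ∏ v ∈ S, f v (localPiEquiv L (IsCMField.complexConj L) N H v (evalPlace (↥(maximalRealSubfield L)) L (IsCMField.complexConj L) N H v b))) →
        (∀ v, v ∉ S₁ → evalPlace (↥(maximalRealSubfield L)) L (IsCMField.complexConj L) N H v (finPart (↥(maximalRealSubfield L)) L (IsCMField.complexConj L) N H g) ∈ localInt L (IsCMField.complexConj L) N H v) →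
        S₀ ⊆ S₁ →
        Integrable (descConj (finPart (↥(maximalRealSubfield L)) L (IsCMField.complexConj L) N H g) (Subgroup.centralizer ({(finPart (↥(maximalRealSubfield L)) L (IsCMField.complexConj L) N H g)} : Set (finAdelic (↥(maximalRealSubfield L)) L (IsCMField.complexConj L) N H))) (centralizer_comm _) F)
          (finAdelicOrbitalMeasureOfLocal L N H g m S₀) →
          Tendsto (fun U : Finset (HeightOneSpectrum (𝓞 ↥(maximalRealSubfield L))) =>
              ∏ v ∈ U, localOrbitalIntegral L N H v ((cmDatum L N H).toLocal v g) (f v) (m v)) atTop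
            (𝓝 (orbitalIntegral (finPart (↥(maximalRealSubfield L)) L (IsCMField.complexConj L) N H g) F (finAdelicOrbitalMeasureOfLocal L N H g m S₀))) ∧
          ∀ S₂ : Finset (HeightOneSpectrum (𝓞 ↥(maximalRealSubfield L))),
            (∀ v, v ∉ S₂ → localOrbitalIntegral L N H v ((cmDatum L N H).toLocal v g) (f v) (m v) = 1) →
            orbitalIntegral (finPart (↥(maximalRealSubfield L)) L (IsCMField.complexConj L) N H g) F (finAdelicOrbitalMeasureOfLocal L N H g m S₀) =
              ∏ v ∈ S₂, localOrbitalIntegral L N H v ((cmDatum L N H).toLocal v g) (f v) (m v) := by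
  haveI : ∀ v, SecondCountableTopology (↥(localPi L (IsCMField.complexConj L) N H v)) := fun v => secondCountableTopology_localPi L N (IsCMField.complexConj L) H v
  haveI : ∀ v, LocallyCompactSpace (↥(localPi L (IsCMField.complexConj L) N H v)) := fun v => locallyCompactSpace_localPi L N (IsCMField.complexConj L) H v
  haveI : Countable (HeightOneSpectrum (𝓞 ↥(maximalRealSubfield L))) := countable_heightOneSpectrum ↥(maximalRealSubfield L)
  let ψ' : ∀ v, ↥(localPi L (IsCMField.complexConj L) N H v) ≃ₜ* (cmDatum L N H).Local v := fun v => localPiEquiv L (IsCMField.complexConj L) N H v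
  have hm1' : ∀ v, v ∉ S₀ → m v ((QuotientGroup.mk : (cmDatum L N H).Local v → _) ''
      (⇑(ψ' v).symm ⁻¹' (localInt L (IsCMField.complexConj L) N H v : Set ↥(localPi L (IsCMField.complexConj L) N H v)))) = 1 := by
    intro v hv
    have hpre : ⇑(ψ' v).symm ⁻¹' (localInt L (IsCMField.complexConj L) N H v : Set ↥(localPi L (IsCMField.complexConj L) N H v)) =
        (cmLocalIntegralLevel L N H v : Set ((cmDatum L N H).Local v)) :=
      Set.ext fun x => localPiEquiv_symm_mem_localInt_iff (IsCMField.complexConj L) N H v x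
    rw [hpre]
    exact hm1 v hv
  exact orbitalMeasureOfLocal_spec (fun v => localInt L (IsCMField.complexConj L) N H v) (Lc := fun v => (cmDatum L N H).Local v) ψ'
    (finAdelicEquiv (↥(maximalRealSubfield L)) L (IsCMField.complexConj L) N H) (finPart (↥(maximalRealSubfield L)) L (IsCMField.complexConj L) N H g)
    (fun v => (cmDatum L N H).toLocal v g) (fun v => localPiEquiv_evalPlace_finPart (↥(maximalRealSubfield L)) L (IsCMField.complexConj L) N H v g)
    m hm1' hm

/-- **The finite-adelic factor `Λ_T` of a PURE TENSOR**: for `T` with integral levels off `T.S` and `m v (π U(H)(𝒪_v)) = 1` off `S₀`, if the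
orbital integrand of `Λ_T` at `g_f` is `μ_f`-integrable and the local orbital integrals `Φ_v(g_v, T.loc v)` are `1` off a finite `S₂`, then
`orbitalIntegral g_f Λ_T μ_f = ∏_{v∈S₂} localOrbitalIntegral v g_v (T.loc v) (m v)` — `c = 1` in ★ `exists_orbitalIntegral_finPart_finFactor_eq_smul_prod`
for THIS measure. [cite: Gelbart1975, p. 155 (10.19)] [cite: Rogawski1990, §5.4 p. 72] -/
theorem orbitalIntegral_finPart_finFactor_ofLocal_eq_prod {S₀ : Finset (HeightOneSpectrum (𝓞 ↥(maximalRealSubfield L)))}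
    (hm1 : ∀ v, v ∉ S₀ → m v ((QuotientGroup.mk : (cmDatum L N H).Local v → _) ''
      (cmLocalIntegralLevel L N H v : Set ((cmDatum L N H).Local v))) = 1)
    (hm : ∀ v, v ∈ S₀ → m v ≠ 0) (T : PureTensor L N H) (S₂ : Finset (HeightOneSpectrum (𝓞 ↥(maximalRealSubfield L))))
    (hK : ∀ v ∉ T.S, T.K v = cmLocalIntegralLevel L N H v)
    (hFi : Integrable (descConj (finPart (↥(maximalRealSubfield L)) L (IsCMField.complexConj L) N H g) (Subgroup.centralizer ({(finPart (↥(maximalRealSubfield L)) L (IsCMField.complexConj L) N H g)} : Set (finAdelic (↥(maximalRealSubfield L)) L (IsCMField.complexConj L) N H))) (centralizer_comm _)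
        ({b : finAdelic (↥(maximalRealSubfield L)) L (IsCMField.complexConj L) N H |
            ∀ v ∉ T.S, evalPlace (↥(maximalRealSubfield L)) L (IsCMField.complexConj L) N H v b ∈ localInt L (IsCMField.complexConj L) N H v}.indicator
          (fun b => ∏ v ∈ T.S, T.loc v (localPiEquiv L (IsCMField.complexConj L) N H v (evalPlace (↥(maximalRealSubfield L)) L (IsCMField.complexConj L) N H v b)))))
      (finAdelicOrbitalMeasureOfLocal L N H g m S₀))
    (hf1 : ∀ v, v ∉ S₂ → localOrbitalIntegral L N H v ((cmDatum L N H).toLocal v g) (T.loc v) (m v) = 1) :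
    orbitalIntegral (finPart (↥(maximalRealSubfield L)) L (IsCMField.complexConj L) N H g)
        ({b : finAdelic (↥(maximalRealSubfield L)) L (IsCMField.complexConj L) N H |
            ∀ v ∉ T.S, evalPlace (↥(maximalRealSubfield L)) L (IsCMField.complexConj L) N H v b ∈ localInt L (IsCMField.complexConj L) N H v}.indicator
          (fun b => ∏ v ∈ T.S, T.loc v (localPiEquiv L (IsCMField.complexConj L) N H v (evalPlace (↥(maximalRealSubfield L)) L (IsCMField.complexConj L) N H v b))))
        (finAdelicOrbitalMeasureOfLocal L N H g m S₀) =
      ∏ v ∈ S₂, localOrbitalIntegral L N H v ((cmDatum L N H).toLocal v g) (T.loc v) (m v) := by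
  classical
  obtain ⟨Sg, hSg⟩ := Literature.MeasureTheory.RestrictedProduct.exists_finset_forall_not_mem_apply_mem
    (fun v => localInt L (IsCMField.complexConj L) N H v) (finAdelicEquiv (↥(maximalRealSubfield L)) L (IsCMField.complexConj L) N H (finPart (↥(maximalRealSubfield L)) L (IsCMField.complexConj L) N H g))
  exact ((finAdelicOrbitalMeasureOfLocal_spec L N H g m hm1 hm).2.2.2.2 T.loc _ (T.S ∪ S₀ ∪ Sg)
    (fun S hS b hb => PureTensor.finFactor_eq_prod_of_forall T hK S
      ((Finset.subset_union_left.trans Finset.subset_union_left).trans hS) b hb)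
    (fun v hv => hSg v fun h => hv (Finset.mem_union_right _ h))
    (Finset.subset_union_right.trans Finset.subset_union_left) hFi).2 S₂ hf1

end Fin

/-! ## §2 The adelic orbital measure from an archimedean and finite local ones (`κ = 1`) -/

section Adelic

variable (g : (cmDatum L N H).Adelic)
  [MeasurableSpace ((cmDatum L N H).Adelic ⧸ Subgroup.centralizer ({g} : Set (cmDatum L N H).Adelic))]
  [MeasurableSpace (arch (↥(maximalRealSubfield L)) L (IsCMField.complexConj L) N H ⧸
    Subgroup.centralizer ({archPart (↥(maximalRealSubfield L)) L (IsCMField.complexConj L) N H g} : Set (arch (↥(maximalRealSubfield L)) L (IsCMField.complexConj L) N H)))]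
  [MeasurableSpace (finAdelic (↥(maximalRealSubfield L)) L (IsCMField.complexConj L) N H ⧸ Subgroup.centralizer ({(finPart (↥(maximalRealSubfield L)) L (IsCMField.complexConj L) N H g)} : Set (finAdelic (↥(maximalRealSubfield L)) L (IsCMField.complexConj L) N H)))]
  [∀ v, MeasurableSpace ((cmDatum L N H).Local v ⧸ Subgroup.centralizer ({((cmDatum L N H).toLocal v g)} : Set ((cmDatum L N H).Local v)))]
  (ma : Measure (arch (↥(maximalRealSubfield L)) L (IsCMField.complexConj L) N H ⧸
    Subgroup.centralizer ({archPart (↥(maximalRealSubfield L)) L (IsCMField.complexConj L) N H g} : Set (arch (↥(maximalRealSubfield L)) L (IsCMField.complexConj L) N H))))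
  (m : ∀ v, Measure ((cmDatum L N H).Local v ⧸ Subgroup.centralizer ({((cmDatum L N H).toLocal v g)} : Set ((cmDatum L N H).Local v))))

/-- **The orbital measure on `U(H)(𝔸_{L⁺}) ⧸ C(g)` BUILT FROM LOCAL ONES**: `ma ⊠ (⊗'_v m v)` — ★ `orbitalMeasureOfProd` along
`adelicProdEquiv⁻¹ : U(H)(L ⊗ ℝ) × U(H)(𝔸_f) ≃* U(H)(𝔸)` (`g ↔ (g_∞, g_f)`) of `ma` on `U(H)(L ⊗ ℝ) ⧸ C(g_∞)` and
`finAdelicOrbitalMeasureOfLocal L N H g m S₀` on `U(H)(𝔸_f) ⧸ C(g_f)`. [cite: Rogawski1990, §5.4 p. 72] [cite: BorelJacquet1979, §4.1] -/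
def adelicOrbitalMeasureOfLocal (S₀ : Finset (HeightOneSpectrum (𝓞 ↥(maximalRealSubfield L)))) :
    Measure ((cmDatum L N H).Adelic ⧸ Subgroup.centralizer ({g} : Set (cmDatum L N H).Adelic)) :=
  orbitalMeasureOfProd (G := (cmDatum L N H).Adelic) (adelicProdEquiv (↥(maximalRealSubfield L)) L (IsCMField.complexConj L) N H).symm.toMulEquiv
    (γ₁ := archPart (↥(maximalRealSubfield L)) L (IsCMField.complexConj L) N H g)
    (γ₂ := finPart (↥(maximalRealSubfield L)) L (IsCMField.complexConj L) N H g)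
    (adelicProdEquiv_symm_archPart_finPart L N H g) ma (finAdelicOrbitalMeasureOfLocal L N H g m S₀)

variable [BorelSpace ((cmDatum L N H).Adelic ⧸ Subgroup.centralizer ({g} : Set (cmDatum L N H).Adelic))]
  [BorelSpace (arch (↥(maximalRealSubfield L)) L (IsCMField.complexConj L) N H ⧸
    Subgroup.centralizer ({archPart (↥(maximalRealSubfield L)) L (IsCMField.complexConj L) N H g} : Set (arch (↥(maximalRealSubfield L)) L (IsCMField.complexConj L) N H)))]
  [BorelSpace (finAdelic (↥(maximalRealSubfield L)) L (IsCMField.complexConj L) N H ⧸ Subgroup.centralizer ({(finPart (↥(maximalRealSubfield L)) L (IsCMField.complexConj L) N H g)} : Set (finAdelic (↥(maximalRealSubfield L)) L (IsCMField.complexConj L) N H)))]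
  [∀ v, BorelSpace ((cmDatum L N H).Local v ⧸ Subgroup.centralizer ({((cmDatum L N H).toLocal v g)} : Set ((cmDatum L N H).Local v)))]
  [SMulInvariantMeasure (arch (↥(maximalRealSubfield L)) L (IsCMField.complexConj L) N H) _ ma] [IsFiniteMeasureOnCompacts ma] [SFinite ma]
  [∀ v, SMulInvariantMeasure ((cmDatum L N H).Local v)
    ((cmDatum L N H).Local v ⧸ Subgroup.centralizer ({((cmDatum L N H).toLocal v g)} : Set ((cmDatum L N H).Local v))) (m v)]
  [∀ v, IsFiniteMeasureOnCompacts (m v)]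

/-- **Admissibility and the EXACT `∞ × f` split for `adelicOrbitalMeasureOfLocal`**: for admissible `ma ≠ 0` (s-finite) and admissible `m v`
normalised off `S₀` (`≠ 0` on `S₀`), `μ = adelicOrbitalMeasureOfLocal L N H g ma m S₀` is invariant, finite on compacta and non-zero, and for EVERY
`F, F₁, F₂` with `F(x) = F₁(x_∞) · F₂(x_f)`: `orbitalIntegral g F μ = orbitalIntegral g_∞ F₁ ma · orbitalIntegral g_f F₂ μ_f` (`μ_f` the finite-adelic
measure of §1) — `κ = 1` in ★ `exists_adelicOrbitalIntegral_eq_smul_arch_mul_fin`, no integrability hypothesis.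
[cite: Gelbart1975, p. 155 (10.19)] [cite: Rogawski1990, §5.4 p. 72] -/
theorem adelicOrbitalMeasureOfLocal_spec {S₀ : Finset (HeightOneSpectrum (𝓞 ↥(maximalRealSubfield L)))} (ha : ma ≠ 0)
    (hm1 : ∀ v, v ∉ S₀ → m v ((QuotientGroup.mk : (cmDatum L N H).Local v → _) ''
      (cmLocalIntegralLevel L N H v : Set ((cmDatum L N H).Local v))) = 1)
    (hm : ∀ v, v ∈ S₀ → m v ≠ 0) :
    SMulInvariantMeasure (cmDatum L N H).Adelic _ (adelicOrbitalMeasureOfLocal L N H g ma m S₀) ∧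
      IsFiniteMeasureOnCompacts (adelicOrbitalMeasureOfLocal L N H g ma m S₀) ∧
      adelicOrbitalMeasureOfLocal L N H g ma m S₀ ≠ 0 ∧
      ∀ (F : (cmDatum L N H).Adelic → ℂ) (F₁ : arch (↥(maximalRealSubfield L)) L (IsCMField.complexConj L) N H → ℂ)
        (F₂ : finAdelic (↥(maximalRealSubfield L)) L (IsCMField.complexConj L) N H → ℂ),
        (∀ x, F x = F₁ (archPart (↥(maximalRealSubfield L)) L (IsCMField.complexConj L) N H x) *
          F₂ (finPart (↥(maximalRealSubfield L)) L (IsCMField.complexConj L) N H x)) →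
        orbitalIntegral g F (adelicOrbitalMeasureOfLocal L N H g ma m S₀) =
          orbitalIntegral (archPart (↥(maximalRealSubfield L)) L (IsCMField.complexConj L) N H g) F₁ ma *
            orbitalIntegral (finPart (↥(maximalRealSubfield L)) L (IsCMField.complexConj L) N H g) F₂ (finAdelicOrbitalMeasureOfLocal L N H g m S₀) := by
  haveI := locallyCompactSpace_finAdelic (↥(maximalRealSubfield L)) L (IsCMField.complexConj L) N H
  haveI := secondCountableTopology_finAdelic (↥(maximalRealSubfield L)) L (IsCMField.complexConj L) N H
  haveI := t2Space_finAdelic (↥(maximalRealSubfield L)) L (IsCMField.complexConj L) N H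
  have hfin := finAdelicOrbitalMeasureOfLocal_spec L N H g m hm1 hm
  haveI := hfin.1
  haveI := hfin.2.1
  haveI : SFinite (finAdelicOrbitalMeasureOfLocal L N H g m S₀) := by
    haveI : IsLocallyFiniteMeasure (finAdelicOrbitalMeasureOfLocal L N H g m S₀) := isLocallyFiniteMeasure_of_isFiniteMeasureOnCompacts
    haveI : SigmaFinite (finAdelicOrbitalMeasureOfLocal L N H g m S₀) := sigmaFinite_of_locallyFinite
    infer_instance
  let E := adelicProdEquiv (↥(maximalRealSubfield L)) L (IsCMField.complexConj L) N H
  let e : arch (↥(maximalRealSubfield L)) L (IsCMField.complexConj L) N H ×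
      finAdelic (↥(maximalRealSubfield L)) L (IsCMField.complexConj L) N H ≃* (cmDatum L N H).Adelic := E.symm.toMulEquiv
  have he : Continuous e := E.symm.continuous
  have hes : Continuous e.symm := E.continuous
  have hγ : e (archPart (↥(maximalRealSubfield L)) L (IsCMField.complexConj L) N H g,
      finPart (↥(maximalRealSubfield L)) L (IsCMField.complexConj L) N H g) = g := adelicProdEquiv_symm_archPart_finPart L N H g
  have hdef : adelicOrbitalMeasureOfLocal L N H g ma m S₀ = orbitalMeasureOfProd e hγ ma (finAdelicOrbitalMeasureOfLocal L N H g m S₀) := rfl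
  refine ⟨?_, ?_, ?_, fun F F₁ F₂ hF => ?_⟩
  · rw [hdef]; exact smulInvariantMeasure_orbitalMeasureOfProd e hγ ma _ he
  · rw [hdef]; exact isFiniteMeasureOnCompacts_orbitalMeasureOfProd e hγ ma _ he hes
  · rw [hdef]; exact orbitalMeasureOfProd_ne_zero e hγ ma _ he hes ha hfin.2.2.1
  · have hfac : ∀ a k, F (e (a, k)) = F₁ a * F₂ k := fun a k => by
      have h := E.apply_symm_apply (a, k)
      rw [hF]
      change F₁ (E (E.symm (a, k))).1 * F₂ (E (E.symm (a, k))).2 = _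
      rw [h]
    rw [orbitalIntegral_eq_integral_descConj, orbitalIntegral_eq_integral_descConj, orbitalIntegral_eq_integral_descConj, hdef]
    exact integral_descConj_orbitalMeasureOfProd e hγ ma _ he hes F F₁ F₂ hfac

/-- **The EXACT Euler product of the adelic orbital integral of a PURE TENSOR for `dg = dg_∞ ⊗ ⊗'_v dg_v`**: for `T = f_∞ ⊗ ⊗_v f_v` with
integral levels off `T.S`, admissible `ma ≠ 0`, admissible `m v` normalised off `S₀`, `Λ_T` with `μ_f`-integrable orbital integrand at `g_f`,
and local orbital integrals `Φ_v(g_v, f_v) = 1` off a finite `S₂`: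
`orbitalIntegral g T.eval μ = orbitalIntegral g_∞ T.arch ma · ∏_{v∈S₂} localOrbitalIntegral v g_v (T.loc v) (m v)` — Rogawski's
`Φ(γ, f) = ∏_v Φ(γ_v, f_v)`, NO constant. [cite: Rogawski1990, §5.4 p. 72] [cite: Gelbart1975, p. 155 (10.19)] -/
theorem orbitalIntegral_eval_adelicOrbitalMeasureOfLocal_eq_mul_prod {S₀ : Finset (HeightOneSpectrum (𝓞 ↥(maximalRealSubfield L)))}
    (ha : ma ≠ 0)
    (hm1 : ∀ v, v ∉ S₀ → m v ((QuotientGroup.mk : (cmDatum L N H).Local v → _) ''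
      (cmLocalIntegralLevel L N H v : Set ((cmDatum L N H).Local v))) = 1)
    (hm : ∀ v, v ∈ S₀ → m v ≠ 0) (T : PureTensor L N H) (S₂ : Finset (HeightOneSpectrum (𝓞 ↥(maximalRealSubfield L))))
    (hK : ∀ v ∉ T.S, T.K v = cmLocalIntegralLevel L N H v)
    (hFi : Integrable (descConj (finPart (↥(maximalRealSubfield L)) L (IsCMField.complexConj L) N H g) (Subgroup.centralizer ({(finPart (↥(maximalRealSubfield L)) L (IsCMField.complexConj L) N H g)} : Set (finAdelic (↥(maximalRealSubfield L)) L (IsCMField.complexConj L) N H))) (centralizer_comm _)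
        ({b : finAdelic (↥(maximalRealSubfield L)) L (IsCMField.complexConj L) N H |
            ∀ v ∉ T.S, evalPlace (↥(maximalRealSubfield L)) L (IsCMField.complexConj L) N H v b ∈ localInt L (IsCMField.complexConj L) N H v}.indicator
          (fun b => ∏ v ∈ T.S, T.loc v (localPiEquiv L (IsCMField.complexConj L) N H v (evalPlace (↥(maximalRealSubfield L)) L (IsCMField.complexConj L) N H v b)))))
      (finAdelicOrbitalMeasureOfLocal L N H g m S₀))
    (hf1 : ∀ v, v ∉ S₂ → localOrbitalIntegral L N H v ((cmDatum L N H).toLocal v g) (T.loc v) (m v) = 1) :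
    orbitalIntegral g T.eval (adelicOrbitalMeasureOfLocal L N H g ma m S₀) =
      orbitalIntegral (archPart (↥(maximalRealSubfield L)) L (IsCMField.complexConj L) N H g) T.arch ma *
        ∏ v ∈ S₂, localOrbitalIntegral L N H v ((cmDatum L N H).toLocal v g) (T.loc v) (m v) := by
  rw [(adelicOrbitalMeasureOfLocal_spec L N H g ma m ha hm1 hm).2.2.2 _ _ _ (PureTensor.eval_eq_arch_mul_finFactor T hK),
    orbitalIntegral_finPart_finFactor_ofLocal_eq_prod L N H g m hm1 hm T S₂ hK hFi hf1]

/-- **The same, from integrability at the ADELIC level** (the hypothesis consumers hold: ★ `UnitaryGroupOrbitalTermsIntegrable`): if the orbital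
integrand of `T.eval` at `g` is `μ`-integrable, then either the archimedean orbital integrand of `T.arch` vanishes `ma`-a.e. (both sides are `0`),
or `Λ_T` has a `μ_f`-integrable orbital integrand (Fubini, ★ `integrable_prod_iff`) and the previous theorem applies:
`orbitalIntegral g T.eval μ = orbitalIntegral g_∞ T.arch ma · ∏_{v∈S₂} localOrbitalIntegral v g_v (T.loc v) (m v)`. [cite: Rogawski1990, §5.4 p. 72]
[cite: Gelbart1975, p. 155 (10.19)] -/
theorem orbitalIntegral_eval_adelicOrbitalMeasureOfLocal_eq_mul_prod' {S₀ : Finset (HeightOneSpectrum (𝓞 ↥(maximalRealSubfield L)))}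
    (ha : ma ≠ 0)
    (hm1 : ∀ v, v ∉ S₀ → m v ((QuotientGroup.mk : (cmDatum L N H).Local v → _) ''
      (cmLocalIntegralLevel L N H v : Set ((cmDatum L N H).Local v))) = 1)
    (hm : ∀ v, v ∈ S₀ → m v ≠ 0) (T : PureTensor L N H) (S₂ : Finset (HeightOneSpectrum (𝓞 ↥(maximalRealSubfield L))))
    (hK : ∀ v ∉ T.S, T.K v = cmLocalIntegralLevel L N H v)
    (hFi : Integrable (descConj g (Subgroup.centralizer ({g} : Set (cmDatum L N H).Adelic)) (centralizer_comm _) T.eval)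
      (adelicOrbitalMeasureOfLocal L N H g ma m S₀))
    (hf1 : ∀ v, v ∉ S₂ → localOrbitalIntegral L N H v ((cmDatum L N H).toLocal v g) (T.loc v) (m v) = 1) :
    orbitalIntegral g T.eval (adelicOrbitalMeasureOfLocal L N H g ma m S₀) =
      orbitalIntegral (archPart (↥(maximalRealSubfield L)) L (IsCMField.complexConj L) N H g) T.arch ma *
        ∏ v ∈ S₂, localOrbitalIntegral L N H v ((cmDatum L N H).toLocal v g) (T.loc v) (m v) := by
  classical
  haveI := locallyCompactSpace_finAdelic (↥(maximalRealSubfield L)) L (IsCMField.complexConj L) N H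
  haveI := secondCountableTopology_finAdelic (↥(maximalRealSubfield L)) L (IsCMField.complexConj L) N H
  haveI := t2Space_finAdelic (↥(maximalRealSubfield L)) L (IsCMField.complexConj L) N H
  have hfin := finAdelicOrbitalMeasureOfLocal_spec L N H g m hm1 hm
  haveI := hfin.2.1
  haveI : SFinite (finAdelicOrbitalMeasureOfLocal L N H g m S₀) := by
    haveI : IsLocallyFiniteMeasure (finAdelicOrbitalMeasureOfLocal L N H g m S₀) := isLocallyFiniteMeasure_of_isFiniteMeasureOnCompacts
    haveI : SigmaFinite (finAdelicOrbitalMeasureOfLocal L N H g m S₀) := sigmaFinite_of_locallyFinite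
    infer_instance
  -- the archimedean orbital integrand `A` and the finite-adelic one `B`
  set A := descConj (archPart (↥(maximalRealSubfield L)) L (IsCMField.complexConj L) N H g)
    (Subgroup.centralizer ({archPart (↥(maximalRealSubfield L)) L (IsCMField.complexConj L) N H g} :
      Set (arch (↥(maximalRealSubfield L)) L (IsCMField.complexConj L) N H))) (centralizer_comm _) T.arch with hA_def
  by_cases hA : A =ᵐ[ma] 0
  · have h0 : orbitalIntegral (archPart (↥(maximalRealSubfield L)) L (IsCMField.complexConj L) N H g) T.arch ma = 0 := by
      rw [orbitalIntegral_eq_integral_descConj]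
      exact integral_eq_zero_of_ae hA
    rw [(adelicOrbitalMeasureOfLocal_spec L N H g ma m ha hm1 hm).2.2.2 _ _ _ (PureTensor.eval_eq_arch_mul_finFactor T hK), h0,
      zero_mul, zero_mul]
  · -- Fubini: some archimedean fibre with `A a ≠ 0` has an integrable finite-adelic factor
    let E := adelicProdEquiv (↥(maximalRealSubfield L)) L (IsCMField.complexConj L) N H
    let e : arch (↥(maximalRealSubfield L)) L (IsCMField.complexConj L) N H ×
        finAdelic (↥(maximalRealSubfield L)) L (IsCMField.complexConj L) N H ≃* (cmDatum L N H).Adelic := E.symm.toMulEquiv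
    have he : Continuous e := E.symm.continuous
    have hes : Continuous e.symm := E.continuous
    have hγ : e (archPart (↥(maximalRealSubfield L)) L (IsCMField.complexConj L) N H g,
        finPart (↥(maximalRealSubfield L)) L (IsCMField.complexConj L) N H g) = g := adelicProdEquiv_symm_archPart_finPart L N H g
    have hdef : adelicOrbitalMeasureOfLocal L N H g ma m S₀ = orbitalMeasureOfProd e hγ ma (finAdelicOrbitalMeasureOfLocal L N H g m S₀) := rfl
    have hfac : ∀ a k, T.eval (e (a, k)) = T.arch a *
        ({b : finAdelic (↥(maximalRealSubfield L)) L (IsCMField.complexConj L) N H |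
            ∀ v ∉ T.S, evalPlace (↥(maximalRealSubfield L)) L (IsCMField.complexConj L) N H v b ∈ localInt L (IsCMField.complexConj L) N H v}.indicator
          (fun b => ∏ v ∈ T.S, T.loc v (localPiEquiv L (IsCMField.complexConj L) N H v (evalPlace (↥(maximalRealSubfield L)) L (IsCMField.complexConj L) N H v b))))
          k := fun a k => by
      have h := E.apply_symm_apply (a, k)
      rw [PureTensor.eval_eq_arch_mul_finFactor T hK]
      change T.arch (E (E.symm (a, k))).1 * Set.indicator _ _ (E (E.symm (a, k))).2 = _
      rw [h]
    rw [hdef] at hFi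
    have hprod := (integrable_descConj_orbitalMeasureOfProd_iff e hγ ma _ he hes _ _ _ hfac).1 hFi
    have h1 := ((integrable_prod_iff hprod.aestronglyMeasurable).1 hprod).1
    have hex : ∃ a, A a ≠ 0 ∧ Integrable (fun k => A a *
        descConj (finPart (↥(maximalRealSubfield L)) L (IsCMField.complexConj L) N H g) _ (centralizer_comm _)
          ({b : finAdelic (↥(maximalRealSubfield L)) L (IsCMField.complexConj L) N H |
              ∀ v ∉ T.S, evalPlace (↥(maximalRealSubfield L)) L (IsCMField.complexConj L) N H v b ∈ localInt L (IsCMField.complexConj L) N H v}.indicator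
            (fun b => ∏ v ∈ T.S, T.loc v (localPiEquiv L (IsCMField.complexConj L) N H v (evalPlace (↥(maximalRealSubfield L)) L (IsCMField.complexConj L) N H v b))))
          k) (finAdelicOrbitalMeasureOfLocal L N H g m S₀) := by
      by_contra hcon
      simp only [not_exists, not_and] at hcon
      exact hA (h1.mono fun a ha => by_contra fun hne => hcon a hne ha)
    obtain ⟨a, hne, hint⟩ := hex
    exact orbitalIntegral_eval_adelicOrbitalMeasureOfLocal_eq_mul_prod L N H g ma m ha hm1 hm T S₂ hK
      ((integrable_const_mul_iff (IsUnit.mk0 _ hne) _).1 hint) hf1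

end Adelic

end UnitaryGroup

end Literature.NumberTheory.Automorphic

end
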